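import Summits.QuantumFields.YangMills.Theorems.QuantileBitPuritySectors
import HarnessLib

/-!
# Route `VirialFluxGap` / `SwapVirialDeficit` (YangMills): the ACTION DEFICIT of a `2L`-slice ring history — definitions

Problem-side definitions shared VERBATIM (same names, same bodies) by the two BC3 «tauber» skeletons of planner ym-idea-4 g14:
LINE «tauber» for the crux `VirialFluxGap.SharpTwistedLaplace` (item stmt-QuantumFields-24204; HOME
bc/g14-A/split/SharpTwistedLaplace_birth.lean, ns `…Cruxes.SharpTwistedLaplace.Tauber`) and LINE «tauber-mean» for the deciding crux
`VirialFluxGap.PeriodicSoftness` (item stmt-QuantumFields-24141; HOME bc/g14-A/PeriodicSoftness_tauber_birth.lean,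
ns `…Cruxes.PeriodicSoftness.TauberMean`), so that their stubs can be landed BY NAME against one tree module (re-registration with
`import …VirialFluxGapRingDeficitDefs` and the local defs dropped, pattern of `FlatTubeReductionPinnedUnitStepExDefs`):

* `ringMeasure L` — the a-priori measure of a `2L`-slice ring history with its seam gauge field: product Haar
  `(⊗_{i ≤ 2L−1} configMeasure) ⊗ gaugeMeasure`;
* `ringExponent L z p` — the exponent `Φ_z` of the sector weight: `log` of the seam-closed chain of transfer kernels at coupling `1`
  (so that `W_z(b) = ∫ exp(b·Φ_z) d(ringMeasure L)`, ✓`TT.SectorSmooth.sectorWeight_one_eq_integral_exp`);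
* `ringDeficit L z p := 12L⁴ − Φ_z(p)` — the ACTION DEFICIT (`≥ 0`, zero exactly on twist-`z` flat histories).

HONEST FRAMING: definitions only (no theorem, no `sorry`); nothing about 24204 / 24141 / the leaf is proved; the Yang–Mills mass gap is
NOT proved.  References: [cite: MontvayMunster1994, (3.145)]; [cite: Luscher1983, §2].
-/

set_option autoImplicit false

noncomputable section

open MeasureTheory
open scoped BigOperators
open Literature.MathematicalPhysics.QuantumFieldTheory hiding SU2
open Summit.QuantumFields.YangMills.Theorems.FemtoTransferGap

namespace Summit.QuantumFields.YangMills.Theorems.VirialFluxGap.RingDeficit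

/-- The a-priori measure of a `2L`-slice ring history with its seam gauge field: product Haar (verbatim from the «tauber» skeletons).
[cite: MontvayMunster1994, (3.145)] -/
def ringMeasure (L : ℕ) [NeZero L] :
    Measure ((Fin (2 * L - 1 + 1) → GaugeConfig 3 L SU2) × (Site 3 L → SU2)) :=
  (Measure.pi fun _ : Fin (2 * L - 1 + 1) => configMeasure SU2 L).prod (TT.gaugeMeasure L)

/-- The exponent `Φ_z` of the sector weight: log of the seam-closed chain of transfer kernels at coupling `1` (verbatim from the
«tauber» skeletons). [cite: Luscher1983, §2] -/
def ringExponent (L : ℕ) [NeZero L] (z : Fin 3 → Bool)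
    (p : (Fin (2 * L - 1 + 1) → GaugeConfig 3 L SU2) × (Site 3 L → SU2)) : ℝ :=
  Real.log ((∏ i : Fin (2 * L - 1), transferKernel su2Rep 1 (p.1 i.castSucc) (p.1 i.succ)) *
    transferKernel su2Rep 1 (p.1 (Fin.last (2 * L - 1))) (gaugeTransform p.2 (TT.twist3 z (p.1 0))))

/-- The ACTION DEFICIT `F_z = 12L⁴ − Φ_z` of a ring history (zero exactly on twist-`z` flat histories; verbatim from the «tauber»
skeletons). [cite: Luscher1983, §2] -/
def ringDeficit (L : ℕ) [NeZero L] (z : Fin 3 → Bool)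
    (p : (Fin (2 * L - 1 + 1) → GaugeConfig 3 L SU2) × (Site 3 L → SU2)) : ℝ :=
  12 * (L : ℝ) ^ 4 - ringExponent L z p

end Summit.QuantumFields.YangMills.Theorems.VirialFluxGap.RingDeficit

end
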